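import Mathlib
import Literature.AlgebraicGeometry.CossartPiltant200819.Thm15iBaseSidePhase2019
import Summits.ResolutionOfSingularities.ResolutionOfSingularities.Theorems.RadicialJungCleanModelsCleanLU3DimThreeCentre
import Literature.AlgebraicGeometry.Resolution.LocalBlowup
import Literature.AlgebraicGeometry.Resolution.ExcellentRings
import Literature.AlgebraicGeometry.Resolution.ExcellentRingsEssFiniteType
import Literature.AlgebraicGeometry.Resolution.ExcellentRingsFieldProofs
import Literature.AlgebraicGeometry.Resolution.TranscendenceDefect
import Summits.ResolutionOfSingularities.ResolutionOfSingularities.Theorems.RadicialJungCleanModelsLens5PTwoPhase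
import HarnessLib

/-!
# Route `RadicialJung`, crux `CleanModels` (stmt-15917): the `p = 2` slice of the node `cleanLU3` from Cossart–Piltant 2019 Thm. 1.5 (i) base-side — part 2/2: the slice and the verbatim-binder wrappers for the skeleton's `by_cases hp2 : p = 2` (source §2/§3)

PORT (line lead `res-B-lead-1` g8, for Sketch rev 33) of res-B-lens-5 g18's PORT-READY, DEF-FREE crux workfile
`Cruxes/DescentPerfectToAll/Lens5_PTwo_CP2019BaseSide.lean` rev 2 (crux file sha16 5f3748133628e111; crit-1 TRIAGE-154 / 154b PASS; re-certified against
Sketch rev 32 by res-B-lens-5 g19), split into two modules; declarations VERBATIM, namespace unchanged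
(`Summit.ResolutionOfSingularities.ResolutionOfSingularities.Theorems.RadicialJung.CleanModels.Lens5.PTwo`).  CONTENT: the `p = 2` SLICE of the node
`cleanLU3` of `Cruxes/CleanModels/Lines/Sketch.lean` (every valuation ring, every ground field of characteristic `2`), KERNEL-CLOSED modulo the typed printed
theorem Cossart–Piltant 2019 Thm. 1.5 (i) read base-side (`Literature.AlgebraicGeometry.CossartPiltant200819.CossartPiltant2019_thm_1_5_i_baseSidePhase`,
INPUTS wi-91399), carried BY NAME (`hBS`) or through its `p = 2` instance (`hBS2`): at `p = 2` the printed end state «multiplicity `< p`» reads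
«`g_n - c² ∉ 𝔪²` for every `c`», which is loose cleanness (form (2) or (3)) on the last regular local ring of the base-side tower, a finitely generated
model by Novacoski–Spivakovsky bookkeeping.  OURS · counted 0 · nothing here proves resolution in characteristic `p`; nothing is claimed about `p ≥ 3`.
This module: `cleanLU3_two_of_baseSidePhaseTwo`, `cleanLU3_two_of_cp2019BaseSidePhase`, `cleanLU3_of_eq_two_of_phaseTwo`, `cleanLU3_of_eq_two`,
`cleanLU3DefectNonDiscrete_of_eq_two_of_phaseTwo`, `cleanLU3DefectNonDiscrete_of_eq_two` (source :271–512).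
-/

noncomputable section

set_option linter.dupNamespace false

open IsLocalRing Polynomial
open Literature.AlgebraicGeometry.Resolution
open Literature.AlgebraicGeometry.CossartPiltant200819
open Summit.ResolutionOfSingularities.ResolutionOfSingularities.Theorems

namespace Summit.ResolutionOfSingularities.ResolutionOfSingularities.Theorems.RadicialJung.CleanModels.Lens5.PTwo


/-! ## §2 The `p = 2` slice of the node `cleanLU3` (every valuation ring, every field of characteristic `2`) -/

/-- **Clean local uniformization at 3-dimensional centres in characteristic `2`, modulo Cossart–Piltant 2019 Thm 1.5 (i) read
base-side.**  For EVERY valuation ring `O` of `K ⊇ k`, `char k = 2`, every finitely generated model `A ⊆ O` with `Frac A = K` whose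
local ring at the centre of `O` is regular of dimension `3`, and every non-square `g₀ ∈ K`: a finitely generated `A ⊆ A' ⊆ O`,
regular at the centre of `O`, carrying there a loosely clean non-trivial representative `c₀² + c₁² g₀` of the `K²`-line of `g₀`
(form (2): a unit not residually a square, or form (3): `s - c'² ∈ 𝔪 ∖ 𝔪²`).  This is the statement of the node `cleanLU3` of
`Cruxes/CleanModels/Lines/Sketch.lean` (rev 31, `cleanLU3_of_stubs`) at `p = 2`, without its hypotheses `ringKrullDim A ≤ 3`
and «all centres above `A` maximal» (not needed).  At `p = 2` multiplicity `< 2` at the last regular local ring of the printed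
tower is cleanness AT THAT RING; nothing is claimed for `p ≥ 3`.
[cite: CossartPiltant2019, Thm. 1.5 (i) pp. 271–272; Cor. 5.6 p. 405; Prop. 2.22 pp. 294–295; CossartPiltant2014, p. 116] -/
theorem cleanLU3_two_of_baseSidePhaseTwo
    (hBS2 : (∀ (S : Type) [CommRing S] [IsRegularLocalRing S],
          IsExcellentRing S → ringKrullDim S = 3 → CharP S 2 →
          ∀ (K : Type) [Field K] [Algebra S K] [IsFractionRing S K] (f : S),
          (∀ c : K, c ^ 2 ≠ algebraMap S K f) →
          ∀ (O : ValuationSubring K), (algebraMap S K).range ≤ O.toSubring →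
          (∀ s ∈ IsLocalRing.maximalIdeal S, O.valuation (algebraMap S K s) < 1) →
          ∃ (n : ℕ) (B : ℕ → Subring K) (g : ℕ → K),
          B 0 = locAtCentre (algebraMap S K).range O ∧ g 0 = algebraMap S K f ∧
          (∀ i ≤ n, B i ≤ O.toSubring ∧ IsRegularLocalRing (B i) ∧ g i ∈ B i) ∧
          (∀ i < n, ∃ P : Ideal (B i), IsRegularLocalRing ((B i) ⧸ P) ∧
            IsLocalBlowupAlong O (B i) P (B (i + 1)) ∧
            ∃ c d : K, c ≠ 0 ∧ g (i + 1) = c ^ 2 * g i + d ^ 2) ∧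
          ∀ (hg : g n ∈ B n) (_hBn : IsRegularLocalRing (B n)) (c : B n),
            (⟨g n, hg⟩ : B n) - c ^ 2 ∉ IsLocalRing.maximalIdeal (B n) ^ 2))
    (k : Type) [Field k] [CharP k 2] (K : Type) [Field K] [Algebra k K]
    (O : ValuationSubring K) (A : Subalgebra k K) (hAO : A.toSubring ≤ O.toSubring) (hAfg : A.FG)
    (hfrac : IsFractionRing A K) (hreg : IsRegularLocalRing (locAtCentre A.toSubring O))
    (hdim3 : ringKrullDim (locAtCentre A.toSubring O) = 3) (g₀ : K) (hg₀ : ∀ c : K, c ^ 2 ≠ g₀) :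
    ∃ (A' : Subalgebra k K), A'.toSubring ≤ O.toSubring ∧ A ≤ A' ∧ A'.FG ∧
    ∃ (_ : IsRegularLocalRing (locAtCentre A'.toSubring O)) (c : Fin 2 → K), (∃ j : Fin 2, (j : ℕ) ≠ 0 ∧ c j ≠ 0) ∧
    ((∃ (d m : ℕ) (hmd : m ≤ d) (t : Fin d → ↥(locAtCentre A'.toSubring O)) (a : Fin m → ℕ) (u : ↥(locAtCentre A'.toSubring O)),
      IsUnit u ∧
    Ideal.span (Set.range t) = IsLocalRing.maximalIdeal ↥(locAtCentre A'.toSubring O) ∧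
    ringKrullDim ↥(locAtCentre A'.toSubring O) = (d : WithBot ℕ∞) ∧ 0 < m ∧ (∀ i, ¬ 2 ∣ a i) ∧
    (∑ j : Fin 2, c j ^ 2 * g₀ ^ (j : ℕ)) = (u : K) * ∏ i : Fin m, ((t (Fin.castLE hmd i) : ↥(locAtCentre A'.toSubring O)) : K) ^ (a i)) ∨
    (∃ u : ↥(locAtCentre A'.toSubring O), IsUnit u ∧ (∑ j : Fin 2, c j ^ 2 * g₀ ^ (j : ℕ)) = (u : K) ∧
    ∀ c' : ↥(locAtCentre A'.toSubring O), u - c' ^ 2 ∉ IsLocalRing.maximalIdeal ↥(locAtCentre A'.toSubring O)) ∨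
    (∃ s c' : ↥(locAtCentre A'.toSubring O), (∑ j : Fin 2, c j ^ 2 * g₀ ^ (j : ℕ)) = (s : K) ∧
    s - c' ^ 2 ∈ IsLocalRing.maximalIdeal ↥(locAtCentre A'.toSubring O) ∧
    s - c' ^ 2 ∉ IsLocalRing.maximalIdeal ↥(locAtCentre A'.toSubring O) ^ 2)) := by
  classical
  obtain ⟨A', hA'O, hAA', hA'fg, -, hregA', C, D, hGmem, hC, hmultG⟩ :=
    exists_lowMultModel_of_baseSidePhaseAt 2 Nat.prime_two hBS2 k K O A hAO hAfg hfrac hreg hdim3 g₀ hg₀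
  haveI := hregA'
  set R : Subring K := locAtCentre A'.toSubring O with hRdef
  let G : R := ⟨C ^ 2 * g₀ + D ^ 2, hGmem⟩
  let cvec : Fin 2 → K := fun j => if (j : ℕ) = 1 then C else D
  have hsum : (∑ j : Fin 2, cvec j ^ 2 * g₀ ^ (j : ℕ)) = (G : K) := by
    rw [Fin.sum_univ_two]
    simp [cvec, G]
    ring
  refine ⟨A', hA'O, hAA', hA'fg, hregA', cvec, ⟨1, by simp, by simpa [cvec] using hC⟩, ?_⟩
  by_cases h : ∃ c' : R, G - c' ^ 2 ∈ IsLocalRing.maximalIdeal R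
  · obtain ⟨c', hc'⟩ := h
    exact Or.inr (Or.inr ⟨G, c', hsum, hc', hmultG c'⟩)
  · push Not at h
    have hGunit : IsUnit G := by
      by_contra hnu
      apply h 0
      rw [zero_pow two_ne_zero, sub_zero]
      exact (IsLocalRing.mem_maximalIdeal G).mpr hnu
    exact Or.inr (Or.inl ⟨G, hGunit, hsum, h⟩)

/-- (rev-1 name, KEPT) the same from the printed fact BY NAME: `cleanLU3_two_of_baseSidePhaseTwo (hBS 2 Nat.prime_two)`.
[cite: CossartPiltant2019, Thm. 1.5 (i) pp. 271–272; Cor. 5.6 p. 405; Prop. 2.22 pp. 294–295] -/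
theorem cleanLU3_two_of_cp2019BaseSidePhase (hBS : CossartPiltant2019_thm_1_5_i_baseSidePhase.{0})
    (k : Type) [Field k] [CharP k 2] (K : Type) [Field K] [Algebra k K]
    (O : ValuationSubring K) (A : Subalgebra k K) (hAO : A.toSubring ≤ O.toSubring) (hAfg : A.FG)
    (hfrac : IsFractionRing A K) (hreg : IsRegularLocalRing (locAtCentre A.toSubring O))
    (hdim3 : ringKrullDim (locAtCentre A.toSubring O) = 3) (g₀ : K) (hg₀ : ∀ c : K, c ^ 2 ≠ g₀) :
    ∃ (A' : Subalgebra k K), A'.toSubring ≤ O.toSubring ∧ A ≤ A' ∧ A'.FG ∧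
    ∃ (_ : IsRegularLocalRing (locAtCentre A'.toSubring O)) (c : Fin 2 → K), (∃ j : Fin 2, (j : ℕ) ≠ 0 ∧ c j ≠ 0) ∧
    ((∃ (d m : ℕ) (hmd : m ≤ d) (t : Fin d → ↥(locAtCentre A'.toSubring O)) (a : Fin m → ℕ) (u : ↥(locAtCentre A'.toSubring O)),
      IsUnit u ∧
    Ideal.span (Set.range t) = IsLocalRing.maximalIdeal ↥(locAtCentre A'.toSubring O) ∧
    ringKrullDim ↥(locAtCentre A'.toSubring O) = (d : WithBot ℕ∞) ∧ 0 < m ∧ (∀ i, ¬ 2 ∣ a i) ∧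
    (∑ j : Fin 2, c j ^ 2 * g₀ ^ (j : ℕ)) = (u : K) * ∏ i : Fin m, ((t (Fin.castLE hmd i) : ↥(locAtCentre A'.toSubring O)) : K) ^ (a i)) ∨
    (∃ u : ↥(locAtCentre A'.toSubring O), IsUnit u ∧ (∑ j : Fin 2, c j ^ 2 * g₀ ^ (j : ℕ)) = (u : K) ∧
    ∀ c' : ↥(locAtCentre A'.toSubring O), u - c' ^ 2 ∉ IsLocalRing.maximalIdeal ↥(locAtCentre A'.toSubring O)) ∨
    (∃ s c' : ↥(locAtCentre A'.toSubring O), (∑ j : Fin 2, c j ^ 2 * g₀ ^ (j : ℕ)) = (s : K) ∧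
    s - c' ^ 2 ∈ IsLocalRing.maximalIdeal ↥(locAtCentre A'.toSubring O) ∧
    s - c' ^ 2 ∉ IsLocalRing.maximalIdeal ↥(locAtCentre A'.toSubring O) ^ 2)) :=
  cleanLU3_two_of_baseSidePhaseTwo (hBS 2 Nat.prime_two) k K O A hAO hAfg hfrac hreg hdim3 g₀ hg₀

/-! ## §3 Verbatim-binder wrappers for the lead's one-line `by_cases hp2 : p = 2` -/

/-- **Wrapper at the level of the node `cleanLU3_of_stubs`** (Sketch rev 31 :420, binder list verbatim, plus `p = 2`): usable as
`exact Lens5.PTwo.cleanLU3_of_eq_two stub_cp2019Thm15iBaseSidePhase p hp hp2 k K O A hAO hAfg hfrac hdimA hreg hdim3 hzd g₀ hg₀`.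
[cite: CossartPiltant2019, Thm. 1.5 (i) pp. 271–272; Cor. 5.6 p. 405; Prop. 2.22 pp. 294–295] -/
theorem cleanLU3_of_eq_two_of_phaseTwo
    (hBS2 : (∀ (S : Type) [CommRing S] [IsRegularLocalRing S],
          IsExcellentRing S → ringKrullDim S = 3 → CharP S 2 →
          ∀ (K : Type) [Field K] [Algebra S K] [IsFractionRing S K] (f : S),
          (∀ c : K, c ^ 2 ≠ algebraMap S K f) →
          ∀ (O : ValuationSubring K), (algebraMap S K).range ≤ O.toSubring →
          (∀ s ∈ IsLocalRing.maximalIdeal S, O.valuation (algebraMap S K s) < 1) →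
          ∃ (n : ℕ) (B : ℕ → Subring K) (g : ℕ → K),
          B 0 = locAtCentre (algebraMap S K).range O ∧ g 0 = algebraMap S K f ∧
          (∀ i ≤ n, B i ≤ O.toSubring ∧ IsRegularLocalRing (B i) ∧ g i ∈ B i) ∧
          (∀ i < n, ∃ P : Ideal (B i), IsRegularLocalRing ((B i) ⧸ P) ∧
            IsLocalBlowupAlong O (B i) P (B (i + 1)) ∧
            ∃ c d : K, c ≠ 0 ∧ g (i + 1) = c ^ 2 * g i + d ^ 2) ∧
          ∀ (hg : g n ∈ B n) (_hBn : IsRegularLocalRing (B n)) (c : B n),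
            (⟨g n, hg⟩ : B n) - c ^ 2 ∉ IsLocalRing.maximalIdeal (B n) ^ 2)) :
    ∀ (p : ℕ), p.Prime → p = 2 →
    ∀ (k : Type) [Field k] [CharP k p] (K : Type) [Field K] [Algebra k K]
    (O : ValuationSubring K) (A : Subalgebra k K), A.toSubring ≤ O.toSubring → A.FG → IsFractionRing A K →
    ringKrullDim A ≤ 3 → IsRegularLocalRing (locAtCentre A.toSubring O) →
    ringKrullDim (locAtCentre A.toSubring O) = 3 →
    (∀ (T : Subring K) (hT : T ≤ O.toSubring), A.toSubring ≤ T → (subringCentre T O hT).IsMaximal) →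
    ∀ g₀ : K, (∀ c : K, c ^ p ≠ g₀) →
    ∃ (A' : Subalgebra k K), A'.toSubring ≤ O.toSubring ∧ A ≤ A' ∧ A'.FG ∧
    ∃ (_ : IsRegularLocalRing (locAtCentre A'.toSubring O)) (c : Fin p → K), (∃ j : Fin p, (j : ℕ) ≠ 0 ∧ c j ≠ 0) ∧
    ((∃ (d m : ℕ) (hmd : m ≤ d) (t : Fin d → ↥(locAtCentre A'.toSubring O)) (a : Fin m → ℕ) (u : ↥(locAtCentre A'.toSubring O)),
      IsUnit u ∧
    Ideal.span (Set.range t) = IsLocalRing.maximalIdeal ↥(locAtCentre A'.toSubring O) ∧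
    ringKrullDim ↥(locAtCentre A'.toSubring O) = (d : WithBot ℕ∞) ∧ 0 < m ∧ (∀ i, ¬ p ∣ a i) ∧
    (∑ j : Fin p, c j ^ p * g₀ ^ (j : ℕ)) = (u : K) * ∏ i : Fin m, ((t (Fin.castLE hmd i) : ↥(locAtCentre A'.toSubring O)) : K) ^ (a i)) ∨
    (∃ u : ↥(locAtCentre A'.toSubring O), IsUnit u ∧ (∑ j : Fin p, c j ^ p * g₀ ^ (j : ℕ)) = (u : K) ∧
    ∀ c' : ↥(locAtCentre A'.toSubring O), u - c' ^ p ∉ IsLocalRing.maximalIdeal ↥(locAtCentre A'.toSubring O)) ∨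
    (∃ s c' : ↥(locAtCentre A'.toSubring O), (∑ j : Fin p, c j ^ p * g₀ ^ (j : ℕ)) = (s : K) ∧
    s - c' ^ p ∈ IsLocalRing.maximalIdeal ↥(locAtCentre A'.toSubring O) ∧
    s - c' ^ p ∉ IsLocalRing.maximalIdeal ↥(locAtCentre A'.toSubring O) ^ 2)) := by
  intro p _hp hp2 k _ _ K _ _ O A hAO hAfg hfrac _hdimA hreg hdim3 _hzd g₀ hg₀
  subst hp2
  exact cleanLU3_two_of_baseSidePhaseTwo hBS2 k K O A hAO hAfg hfrac hreg hdim3 g₀ hg₀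

/-- (rev-1 name, KEPT) the same wrapper from the printed fact BY NAME: `cleanLU3_of_eq_two_of_phaseTwo (hBS 2 Nat.prime_two)`.
[cite: CossartPiltant2019, Thm. 1.5 (i) pp. 271–272; Cor. 5.6 p. 405; Prop. 2.22 pp. 294–295] -/
theorem cleanLU3_of_eq_two (hBS : CossartPiltant2019_thm_1_5_i_baseSidePhase.{0}) :
    ∀ (p : ℕ), p.Prime → p = 2 →
    ∀ (k : Type) [Field k] [CharP k p] (K : Type) [Field K] [Algebra k K]
    (O : ValuationSubring K) (A : Subalgebra k K), A.toSubring ≤ O.toSubring → A.FG → IsFractionRing A K →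
    ringKrullDim A ≤ 3 → IsRegularLocalRing (locAtCentre A.toSubring O) →
    ringKrullDim (locAtCentre A.toSubring O) = 3 →
    (∀ (T : Subring K) (hT : T ≤ O.toSubring), A.toSubring ≤ T → (subringCentre T O hT).IsMaximal) →
    ∀ g₀ : K, (∀ c : K, c ^ p ≠ g₀) →
    ∃ (A' : Subalgebra k K), A'.toSubring ≤ O.toSubring ∧ A ≤ A' ∧ A'.FG ∧
    ∃ (_ : IsRegularLocalRing (locAtCentre A'.toSubring O)) (c : Fin p → K), (∃ j : Fin p, (j : ℕ) ≠ 0 ∧ c j ≠ 0) ∧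
    ((∃ (d m : ℕ) (hmd : m ≤ d) (t : Fin d → ↥(locAtCentre A'.toSubring O)) (a : Fin m → ℕ) (u : ↥(locAtCentre A'.toSubring O)),
      IsUnit u ∧
    Ideal.span (Set.range t) = IsLocalRing.maximalIdeal ↥(locAtCentre A'.toSubring O) ∧
    ringKrullDim ↥(locAtCentre A'.toSubring O) = (d : WithBot ℕ∞) ∧ 0 < m ∧ (∀ i, ¬ p ∣ a i) ∧
    (∑ j : Fin p, c j ^ p * g₀ ^ (j : ℕ)) = (u : K) * ∏ i : Fin m, ((t (Fin.castLE hmd i) : ↥(locAtCentre A'.toSubring O)) : K) ^ (a i)) ∨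
    (∃ u : ↥(locAtCentre A'.toSubring O), IsUnit u ∧ (∑ j : Fin p, c j ^ p * g₀ ^ (j : ℕ)) = (u : K) ∧
    ∀ c' : ↥(locAtCentre A'.toSubring O), u - c' ^ p ∉ IsLocalRing.maximalIdeal ↥(locAtCentre A'.toSubring O)) ∨
    (∃ s c' : ↥(locAtCentre A'.toSubring O), (∑ j : Fin p, c j ^ p * g₀ ^ (j : ℕ)) = (s : K) ∧
    s - c' ^ p ∈ IsLocalRing.maximalIdeal ↥(locAtCentre A'.toSubring O) ∧
    s - c' ^ p ∉ IsLocalRing.maximalIdeal ↥(locAtCentre A'.toSubring O) ^ 2)) :=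
  cleanLU3_of_eq_two_of_phaseTwo (hBS 2 Nat.prime_two)

/-- **Wrapper at the level of the research stub `stub_cleanLU3DefectNonDiscrete`** (Sketch rev 31 :303, binder list verbatim,
plus `p = 2` right after `p.Prime`): the `p = 2` instance of the class-(B) research stub — and of everything else the stub still
quantifies over — is a corollary of the printed theorem; the eleven restricting hypotheses (centres maximal, immediacy, non-zero
transcendence defect, not discrete, no divisorial coarsening, not (perfect and `[Γ:2Γ] = 4`), `k` not algebraically closed, rank
one) are simply not used.  Usable as `exact Lens5.PTwo.cleanLU3DefectNonDiscrete_of_eq_two stub_cp2019Thm15iBaseSidePhase p hp hp2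
k K O A hAO hAfg hfrac hdimA hreg hdim3 hzd g₀ hg₀ hdefect htd hdisc hdiv hT halg hCc`.
[cite: CossartPiltant2019, Thm. 1.5 (i) pp. 271–272; Cor. 5.6 p. 405; Prop. 2.22 pp. 294–295] -/
theorem cleanLU3DefectNonDiscrete_of_eq_two_of_phaseTwo
    (hBS2 : (∀ (S : Type) [CommRing S] [IsRegularLocalRing S],
          IsExcellentRing S → ringKrullDim S = 3 → CharP S 2 →
          ∀ (K : Type) [Field K] [Algebra S K] [IsFractionRing S K] (f : S),
          (∀ c : K, c ^ 2 ≠ algebraMap S K f) →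
          ∀ (O : ValuationSubring K), (algebraMap S K).range ≤ O.toSubring →
          (∀ s ∈ IsLocalRing.maximalIdeal S, O.valuation (algebraMap S K s) < 1) →
          ∃ (n : ℕ) (B : ℕ → Subring K) (g : ℕ → K),
          B 0 = locAtCentre (algebraMap S K).range O ∧ g 0 = algebraMap S K f ∧
          (∀ i ≤ n, B i ≤ O.toSubring ∧ IsRegularLocalRing (B i) ∧ g i ∈ B i) ∧
          (∀ i < n, ∃ P : Ideal (B i), IsRegularLocalRing ((B i) ⧸ P) ∧
            IsLocalBlowupAlong O (B i) P (B (i + 1)) ∧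
            ∃ c d : K, c ≠ 0 ∧ g (i + 1) = c ^ 2 * g i + d ^ 2) ∧
          ∀ (hg : g n ∈ B n) (_hBn : IsRegularLocalRing (B n)) (c : B n),
            (⟨g n, hg⟩ : B n) - c ^ 2 ∉ IsLocalRing.maximalIdeal (B n) ^ 2)) :
    ∀ (p : ℕ), p.Prime → p = 2 →
    ∀ (k : Type) [Field k] [CharP k p] (K : Type) [Field K] [Algebra k K]
    (O : ValuationSubring K) (A : Subalgebra k K), A.toSubring ≤ O.toSubring → A.FG → IsFractionRing A K →
    ringKrullDim A ≤ 3 → IsRegularLocalRing (locAtCentre A.toSubring O) →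
    ringKrullDim (locAtCentre A.toSubring O) = 3 →
    (∀ (T : Subring K) (hT : T ≤ O.toSubring), A.toSubring ≤ T → (subringCentre T O hT).IsMaximal) →
    ∀ g₀ : K, (∀ c : K, c ^ p ≠ g₀) →
    (∀ f₀ : K, ∃ f₁ : K, O.valuation (g₀ - f₁ ^ p) < O.valuation (g₀ - f₀ ^ p)) →
    (∀ hk : ∀ c : k, algebraMap k K c ∈ O, transcendenceDefect k O hk ≠ 0) →
    ¬ (∃ π : K, π ≠ 0 ∧ (∀ x : K, O.valuation x < 1 → O.valuation x ≤ O.valuation π) ∧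
      (∀ x : K, x ≠ 0 → ∃ n : ℕ, O.valuation π ^ n ≤ O.valuation x)) →
    ¬ (∃ (O₁ : ValuationSubring K), O ≤ O₁ ∧ O₁ ≠ ⊤ ∧ ∃ y : Fin 2 → K, (∀ i, y i ∈ O) ∧
      ∀ P : MvPolynomial (Fin 2) k, P ≠ 0 → O₁.valuation (MvPolynomial.aeval y P) = 1) →
    ¬ (PerfectField k ∧ ∃ x y : K, x ≠ 0 ∧ y ≠ 0 ∧ ∀ a b : ℕ, a < p → b < p → (a ≠ 0 ∨ b ≠ 0) →
      ∀ z : K, z ≠ 0 → O.valuation (x ^ a * y ^ b) ≠ O.valuation (z ^ p)) →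
    ¬ IsAlgClosed k →
    ¬ (∃ O₁ : ValuationSubring K, O ≤ O₁ ∧ O₁ ≠ O ∧ O₁ ≠ ⊤) →
    ∃ (A' : Subalgebra k K), A'.toSubring ≤ O.toSubring ∧ A ≤ A' ∧ A'.FG ∧
    ∃ (_ : IsRegularLocalRing (locAtCentre A'.toSubring O)) (c : Fin p → K), (∃ j : Fin p, (j : ℕ) ≠ 0 ∧ c j ≠ 0) ∧
    ((∃ (d m : ℕ) (hmd : m ≤ d) (t : Fin d → ↥(locAtCentre A'.toSubring O)) (a : Fin m → ℕ) (u : ↥(locAtCentre A'.toSubring O)),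
      IsUnit u ∧
    Ideal.span (Set.range t) = IsLocalRing.maximalIdeal ↥(locAtCentre A'.toSubring O) ∧
    ringKrullDim ↥(locAtCentre A'.toSubring O) = (d : WithBot ℕ∞) ∧ 0 < m ∧ (∀ i, ¬ p ∣ a i) ∧
    (∑ j : Fin p, c j ^ p * g₀ ^ (j : ℕ)) = (u : K) * ∏ i : Fin m, ((t (Fin.castLE hmd i) : ↥(locAtCentre A'.toSubring O)) : K) ^ (a i)) ∨
    (∃ u : ↥(locAtCentre A'.toSubring O), IsUnit u ∧ (∑ j : Fin p, c j ^ p * g₀ ^ (j : ℕ)) = (u : K) ∧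
    ∀ c' : ↥(locAtCentre A'.toSubring O), u - c' ^ p ∉ IsLocalRing.maximalIdeal ↥(locAtCentre A'.toSubring O)) ∨
    (∃ s c' : ↥(locAtCentre A'.toSubring O), (∑ j : Fin p, c j ^ p * g₀ ^ (j : ℕ)) = (s : K) ∧
    s - c' ^ p ∈ IsLocalRing.maximalIdeal ↥(locAtCentre A'.toSubring O) ∧
    s - c' ^ p ∉ IsLocalRing.maximalIdeal ↥(locAtCentre A'.toSubring O) ^ 2)) := by
  intro p _hp hp2 k _ _ K _ _ O A hAO hAfg hfrac _hdimA hreg hdim3 _hzd g₀ hg₀ _hdefect _htd _hdisc _hdiv _hT _halg _hCc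
  subst hp2
  exact cleanLU3_two_of_baseSidePhaseTwo hBS2 k K O A hAO hAfg hfrac hreg hdim3 g₀ hg₀

/-- (rev-1 name, KEPT) the same wrapper from the printed fact BY NAME: `cleanLU3DefectNonDiscrete_of_eq_two_of_phaseTwo (hBS 2 Nat.prime_two)`.
[cite: CossartPiltant2019, Thm. 1.5 (i) pp. 271–272; Cor. 5.6 p. 405; Prop. 2.22 pp. 294–295] -/
theorem cleanLU3DefectNonDiscrete_of_eq_two (hBS : CossartPiltant2019_thm_1_5_i_baseSidePhase.{0}) :
    ∀ (p : ℕ), p.Prime → p = 2 →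
    ∀ (k : Type) [Field k] [CharP k p] (K : Type) [Field K] [Algebra k K]
    (O : ValuationSubring K) (A : Subalgebra k K), A.toSubring ≤ O.toSubring → A.FG → IsFractionRing A K →
    ringKrullDim A ≤ 3 → IsRegularLocalRing (locAtCentre A.toSubring O) →
    ringKrullDim (locAtCentre A.toSubring O) = 3 →
    (∀ (T : Subring K) (hT : T ≤ O.toSubring), A.toSubring ≤ T → (subringCentre T O hT).IsMaximal) →
    ∀ g₀ : K, (∀ c : K, c ^ p ≠ g₀) →
    (∀ f₀ : K, ∃ f₁ : K, O.valuation (g₀ - f₁ ^ p) < O.valuation (g₀ - f₀ ^ p)) →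
    (∀ hk : ∀ c : k, algebraMap k K c ∈ O, transcendenceDefect k O hk ≠ 0) →
    ¬ (∃ π : K, π ≠ 0 ∧ (∀ x : K, O.valuation x < 1 → O.valuation x ≤ O.valuation π) ∧
      (∀ x : K, x ≠ 0 → ∃ n : ℕ, O.valuation π ^ n ≤ O.valuation x)) →
    ¬ (∃ (O₁ : ValuationSubring K), O ≤ O₁ ∧ O₁ ≠ ⊤ ∧ ∃ y : Fin 2 → K, (∀ i, y i ∈ O) ∧
      ∀ P : MvPolynomial (Fin 2) k, P ≠ 0 → O₁.valuation (MvPolynomial.aeval y P) = 1) →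
    ¬ (PerfectField k ∧ ∃ x y : K, x ≠ 0 ∧ y ≠ 0 ∧ ∀ a b : ℕ, a < p → b < p → (a ≠ 0 ∨ b ≠ 0) →
      ∀ z : K, z ≠ 0 → O.valuation (x ^ a * y ^ b) ≠ O.valuation (z ^ p)) →
    ¬ IsAlgClosed k →
    ¬ (∃ O₁ : ValuationSubring K, O ≤ O₁ ∧ O₁ ≠ O ∧ O₁ ≠ ⊤) →
    ∃ (A' : Subalgebra k K), A'.toSubring ≤ O.toSubring ∧ A ≤ A' ∧ A'.FG ∧
    ∃ (_ : IsRegularLocalRing (locAtCentre A'.toSubring O)) (c : Fin p → K), (∃ j : Fin p, (j : ℕ) ≠ 0 ∧ c j ≠ 0) ∧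
    ((∃ (d m : ℕ) (hmd : m ≤ d) (t : Fin d → ↥(locAtCentre A'.toSubring O)) (a : Fin m → ℕ) (u : ↥(locAtCentre A'.toSubring O)),
      IsUnit u ∧
    Ideal.span (Set.range t) = IsLocalRing.maximalIdeal ↥(locAtCentre A'.toSubring O) ∧
    ringKrullDim ↥(locAtCentre A'.toSubring O) = (d : WithBot ℕ∞) ∧ 0 < m ∧ (∀ i, ¬ p ∣ a i) ∧
    (∑ j : Fin p, c j ^ p * g₀ ^ (j : ℕ)) = (u : K) * ∏ i : Fin m, ((t (Fin.castLE hmd i) : ↥(locAtCentre A'.toSubring O)) : K) ^ (a i)) ∨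
    (∃ u : ↥(locAtCentre A'.toSubring O), IsUnit u ∧ (∑ j : Fin p, c j ^ p * g₀ ^ (j : ℕ)) = (u : K) ∧
    ∀ c' : ↥(locAtCentre A'.toSubring O), u - c' ^ p ∉ IsLocalRing.maximalIdeal ↥(locAtCentre A'.toSubring O)) ∨
    (∃ s c' : ↥(locAtCentre A'.toSubring O), (∑ j : Fin p, c j ^ p * g₀ ^ (j : ℕ)) = (s : K) ∧
    s - c' ^ p ∈ IsLocalRing.maximalIdeal ↥(locAtCentre A'.toSubring O) ∧
    s - c' ^ p ∉ IsLocalRing.maximalIdeal ↥(locAtCentre A'.toSubring O) ^ 2)) :=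
  cleanLU3DefectNonDiscrete_of_eq_two_of_phaseTwo (hBS 2 Nat.prime_two)


end Summit.ResolutionOfSingularities.ResolutionOfSingularities.Theorems.RadicialJung.CleanModels.Lens5.PTwo
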